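import Mathlib
import Summits.ValiantsHypothesis.ValiantsHypothesis.Theses.ElementaryWordLength
import Summits.ValiantsHypothesis.ValiantsHypothesis.Theorems.ElementaryWordLengthWordPerSuperQuarticPatternGlue
import Summits.ValiantsHypothesis.ValiantsHypothesis.Theorems.ElementaryWordLengthWordPerSuperQuarticPatternConverse
-- (landed p120036; import once built on the farm — vocabulary only, not needed below)
-- import Summits.ValiantsHypothesis.ValiantsHypothesis.Theorems.ElementaryWordLengthWordPerSuperQuarticPatternEquivalence
import Summits.ValiantsHypothesis.ValiantsHypothesis.Theorems.ElementaryWordLengthWordPerSuperQuarticChainSumRule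
import Summits.ValiantsHypothesis.ValiantsHypothesis.Theorems.ElementaryWordLengthWordPerSuperQuarticChainLayer
import Summits.ValiantsHypothesis.ValiantsHypothesis.Theorems.ElementaryWordLengthWordPerSuperQuarticChainCoeffCons
import Summits.ValiantsHypothesis.ValiantsHypothesis.Theorems.ElementaryWordLengthWordPerSuperQuarticChainSqRule
import Summits.ValiantsHypothesis.ValiantsHypothesis.Theorems.ElementaryWordLengthWordPerSuperQuarticChainReadOnce
import Summits.ValiantsHypothesis.ValiantsHypothesis.Theorems.ElementaryWordLengthWordPerSuperQuarticChainHardnessFloor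
import Summits.ValiantsHypothesis.ValiantsHypothesis.Theorems.ElementaryWordLengthWordPerSuperQuarticStubChainResolvent
-- (landed p118632; import once built on the farm — vocabulary only, not needed below)
-- import Summits.ValiantsHypothesis.ValiantsHypothesis.Theorems.ElementaryWordLengthWordPerSuperQuarticStubChainDetForm

/-!
# Line `Sketch` (idea `signature-noncontainment`) — skeleton for crux
# `ElementaryWordLength.WordPerSuperQuartic` (stmt-ValiantsHypothesis-6624), INTEGRATED form (lead c4, end of cycle 5)

Crux (by name): `Summit.ValiantsHypothesis.ValiantsHypothesis.Theses.ElementaryWordLength.WordPerSuperQuartic`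
— for some `ε > 0` and all large `n`, every affine elementary word for `E_02(per_n)` has length `≥ n^(4+ε)`.

Everything this line produced is LANDED under `Theorems/ElementaryWordLengthWordPerSuperQuartic*.lean`
(`--supports stmt-ValiantsHypothesis-6624`) and imported above; the skeleton is reduced to its one open stub S1b'
`stub_patternChainHardness` and the one-line composition.  The stub is EQUIVALENT to the crux
(`patternChainHardness_iff_wordPerSuperQuartic`, `Theorems/…PatternEquivalence.lean`): pattern restriction plus the
chain normal form are a faithful normal form of the word model for `per_n`.  See `Lines/Sketch.dead.md` and
`Cruxes/WordPerSuperQuartic/NOTES.md` (cycle reports 1–5) for the calibration and for what a line would need here.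

Landed pieces (all `Summit.ValiantsHypothesis.ValiantsHypothesis.Theorems.WordPerSuperQuartic.*`): word → chain
`stub_chainNormalForm` (p108980); chain → word `chain_to_word` (p119212; `stub_squareZeroFactor` p116340,
`stub_pairCompletion` p116632, `stub_chainToWord` p116684); pattern glue `wordPerSuperQuartic_of_patternChainHardness`,
`wordPerSuperQuartic_of_patternBlockHardness`, `patternChainHardness_of_chainHardness` (p119210; `stub_patternCount`
p116261, `stub_wordSubst` p104130, `rename_wordProd`/`rename_prodMap_perPoly_eq`/… p107551); transversal glue
`wordPerSuperQuartic_of_blockHardness` (p107551; `stub_blockTransport` p104298, `stub_blockCount` p104282, `stub_arith`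
p104183); converse `patternChainHardness_of_wordPerSuperQuartic` (p119212; `stub_converseArith` p116332); chain calculus
`chain_sum_reads_eq`/`chain_constantCoeff`/`chain_coeff_single` (p109728), `chain_coeff_layer` (p110618),
`chain_coeff_cons` (p112168), `chain_sq_reads_eq` (p112219), `chain_read_once` (p112552), `chainHardness_floor`
(p114531), `stub_chainResolvent` (p116742), `stub_chainDetForm` (p118632).

## Disproof.lean used
None exists for this crux (`ledger crux ls`, 18:15Z).
-/

noncomputable section

-- `Summit.ValiantsHypothesis.ValiantsHypothesis.…` is the tree's mandated single-conjunct layout.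
set_option linter.dupNamespace false

namespace Summit.ValiantsHypothesis.ValiantsHypothesis.Cruxes.WordPerSuperQuartic.SignatureNoncontainment

open Literature.Computability.AlgebraicComplexity MvPolynomial
open Summit.ValiantsHypothesis.ValiantsHypothesis.Theorems.WordPerSuperQuartic

/-- S1b' — **pattern chain hardness** (the open content, held by the lead; the weakest form of C⁺ that
closes the crux).  For some `ε > 0` and all large `n` there are a nonempty set `S` of variable positions
and complex values `x` for the variables off `S` such that every chain `Π_t (1 + x_{v_t}·N_t)` of
constant square-zero `3 × 3` matrices reading only `S` that equals `E_02(P − P(0))`, `P` the restriction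
of `per_n` at `x` off `S`, has more than `|S|·n^(2+ε)` factors. -/
theorem stub_patternChainHardness :
    ∃ ε : ℝ, 0 < ε ∧ ∃ n₀ : ℕ, ∀ n ≥ n₀, ∃ S : Finset (Fin n × Fin n), 0 < S.card ∧
      ∃ x : Fin n × Fin n → ℂ, ∀ L : List ((Fin n × Fin n) × Matrix (Fin 3) (Fin 3) ℂ),
        (∀ e ∈ L, e.1 ∈ S) →
        (∀ e ∈ L, e.2 * e.2 = 0) →
        (L.map (fun e => (1 : Matrix (Fin 3) (Fin 3) (MvPolynomial (Fin n × Fin n) ℂ)) +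
            (MvPolynomial.X e.1 : MvPolynomial (Fin n × Fin n) ℂ) •
              e.2.map (MvPolynomial.C : ℂ → MvPolynomial (Fin n × Fin n) ℂ))).prod =
          Matrix.transvection (0 : Fin 3) 2
            (MvPolynomial.aeval (fun v : Fin n × Fin n =>
                if v ∈ S then MvPolynomial.X v else MvPolynomial.C (x v)) (perPoly (Fin n) ℂ) -
              MvPolynomial.C (MvPolynomial.constantCoeff (MvPolynomial.aeval (fun v : Fin n × Fin n =>
                if v ∈ S then MvPolynomial.X v else MvPolynomial.C (x v)) (perPoly (Fin n) ℂ)))) →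
        (S.card : ℝ) * (n : ℝ) ^ (2 + ε) < (L.length : ℝ) := by
  sorry

/-- **The line concludes the crux BY NAME** (modulo the one open stub S1b'): pattern glue, landed. -/
theorem WordPerSuperQuartic_of :
    Summit.ValiantsHypothesis.ValiantsHypothesis.Theses.ElementaryWordLength.WordPerSuperQuartic :=
  wordPerSuperQuartic_of_patternChainHardness stub_patternChainHardness

/-- **The open stub is equivalent to the crux** (landed as `patternChainHardness_iff_wordPerSuperQuartic`, p120036). -/
theorem stub_patternChainHardness_iff_crux :
    (∃ ε : ℝ, 0 < ε ∧ ∃ n₀ : ℕ, ∀ n ≥ n₀, ∃ S : Finset (Fin n × Fin n), 0 < S.card ∧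
      ∃ x : Fin n × Fin n → ℂ, ∀ L : List ((Fin n × Fin n) × Matrix (Fin 3) (Fin 3) ℂ),
        (∀ e ∈ L, e.1 ∈ S) →
        (∀ e ∈ L, e.2 * e.2 = 0) →
        (L.map (fun e => (1 : Matrix (Fin 3) (Fin 3) (MvPolynomial (Fin n × Fin n) ℂ)) +
            (MvPolynomial.X e.1 : MvPolynomial (Fin n × Fin n) ℂ) •
              e.2.map (MvPolynomial.C : ℂ → MvPolynomial (Fin n × Fin n) ℂ))).prod =
          Matrix.transvection (0 : Fin 3) 2
            (MvPolynomial.aeval (fun v : Fin n × Fin n =>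
                if v ∈ S then MvPolynomial.X v else MvPolynomial.C (x v)) (perPoly (Fin n) ℂ) -
              MvPolynomial.C (MvPolynomial.constantCoeff (MvPolynomial.aeval (fun v : Fin n × Fin n =>
                if v ∈ S then MvPolynomial.X v else MvPolynomial.C (x v)) (perPoly (Fin n) ℂ)))) →
        (S.card : ℝ) * (n : ℝ) ^ (2 + ε) < (L.length : ℝ)) ↔
    Summit.ValiantsHypothesis.ValiantsHypothesis.Theses.ElementaryWordLength.WordPerSuperQuartic :=
  ⟨wordPerSuperQuartic_of_patternChainHardness, patternChainHardness_of_wordPerSuperQuartic⟩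

end Summit.ValiantsHypothesis.ValiantsHypothesis.Cruxes.WordPerSuperQuartic.SignatureNoncontainment

end
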